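import Summits.QuantumFields.YangMills.Theorems.FluctuationComparisonRegPrIntLOrganTangentFibredChartDescendTo
import Summits.QuantumFields.YangMills.Theorems.FluctuationComparisonRegPrIntLOrganTangentModeLettersFromHeight
import Summits.QuantumFields.YangMills.Theorems.FluctuationComparisonRegPrIntLOrganTangentFibreMeanToolsAnyCut
import HarnessLib

/-!
# `FluctuationComparisonRegPrIntLOrganTangentMultiWindowWeight` — (L19) THE MULTI-LEVEL-WINDOW WEIGHT `χ_{j,K} = ∏_{j<n≤K} sfCut θ_n ∘ descendTo n K` IS A KNIT-MW WEIGHT: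
# continuous (from a height), `0 ≤ χ ≤ 1`, supported in `MW_{j,K}`, positive on `MW_{j,K}` — the `χ`-binders of ✓(L17) `…FibreMeanVersionKnitDescendTo` for the frame's own weight

Cell `ym3-torus` (rung R3 = continuum `SU(2)` Yang–Mills on T³ — NOT d = 4, NOT infinite volume, NOT a mass gap, NOT Clay), width seat `ym-ust-20520-w5` (gen 22),
pen (L19).  `--kind proof --supports stmt-QuantumFields-20520 --as helper`, count-neutral, definition-free, default heartbeats; THEOREMS ONLY; nothing printed is asserted.

WHAT.  The v18 m-step rows localise the fibre mean by the product of the tower's own cut-offs (LEAD w3 g24 WORD №2; V18-TYPING-SPEC §3), i.e. by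
`χ_{j,K} U := ∏_{i < K−j} sfCut θ_{j+1+i} (descendTo F ℰp (j+1+i) K U)` with the R-CUT-χ token `sfCut θ V = ∏ p, max 0 (min 1 ((24∕25·θ − dist1 (plaqHol V p)) ∕ ((24∕25 − 1∕2)·θ)))`
(written, as in ✓(L18) `towerCut_iterate`, with the proof-free factor `if h : j+1+i ≤ K then … else 1`).  ✓(L17) KNIT-MW asks of the weight: `Continuous χ`, `0 ≤ χ`, `χ U ≠ 0 → U ∈ MW`,
`U ∈ MW → 0 < χ U`.  The last three are per-factor facts (✓TOOLSc `sfCutRamp_nonneg ∕ _le_one ∕ plaqSmall_of_sfCutRamp_ne_zero ∕ sfCutRamp_pos_of_plaqSmall`); CONTINUITY is not —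
Bałaban's exp-mean-log average `descend` is continuous only near fields whose path holonomies cluster (✓(L9) `continuousOn_descend_of_small`: on `{PlaqSmall a}` whenever
`((5L)²∕4)·a < δ₂`).  The product is nevertheless globally continuous: at a point where the top factor vanishes it kills the bounded (`≤ 1`) deeper factors; where it does not, the
field is `24∕25·θ_K`-small and `descend` is continuous there from a height — induction on `K`.
§1 GENERIC (any factor family `t n : G_n → ℝ` continuous with `0 ≤ t ≤ 1` and `t n U ≠ 0 → PlaqSmall (a n) U`, any radii `a`): `iterWeight_nonneg`, `iterWeight_le_one`,
`multiWindow_of_iterWeight_ne_zero`, `iterWeight_pos_of_multiWindow` (given `PlaqSmall (a n) U → 0 < t n U`), ★★`continuous_iterWeight` (given `ContinuousOn (descend F ℰp n)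
{PlaqSmall (a (n+1))}` for `j ≤ n < K` and the windows `{PlaqSmall (a n)}` open — automatic).
§2 THE FRAME'S WEIGHT FROM A HEIGHT: ★★★`exists_height_multiWindowWeight` — for every `F`, `0 < γ ≤ 1`, `0 < b₀`: `∃ jA, ∀ j ≥ jA, ∀ K ≥ j+1`, the four KNIT-MW letters for
`χ_{j,K}` at `t n := sfCut θ_n`, `a n := 24∕25·θ_n` (✓`tendsto_θBal_atTop` puts `((5L)²∕4)·(24∕25)θ_n` below `δ₂` from a height).
NOT HERE: the v18 row texts; nothing of Bałaban's estimates.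
[cite: Balaban1987RG1, (0.4) p.253, (0.11) p.253, (0.18) p.255; Balaban1985Averaging, (10)-(13) p.19; Balaban1985UV3, (7) p.257]

HONEST: continuity bookkeeping + compositions of landed kernel facts; nothing of Bałaban's RG estimates is asserted or proved; O1 ∕ O1ᵘ-H ∕ m-step rows ∕ crux 20520
`FluctuationComparisonRegPrIntL` ∕ `YM3TorusSU2` NOT proved; registry `Lines/semiclassical_s2beta.lean` v11.4 (★★OWNER RULING №36) untouched; rung R3 = SU(2) YM₃ on T³ — NOT d = 4,
NOT infinite volume, NOT a mass gap, NOT Clay; the Yang–Mills mass gap is NOT proved by any of this.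
-/

set_option autoImplicit false

noncomputable section

namespace Summit.QuantumFields.YangMills.Theorems.FluctuationComparisonRegPrIntLOrganTangentMultiWindowWeight

open MeasureTheory Filter Topology Set Function
open scoped ENNReal NNReal
open Literature.MathematicalPhysics.QuantumFieldTheory.Balaban1983to89
open T3ContinuumYM3Torus T3NestedUnitLaws T3UnitLawDensityEML T3UnitScaleTilt T3LevelShift T3TiltDescent
open Literature.MathematicalPhysics.QuantumFieldTheory.Balaban1983to89.T3OrbitAverage
open Literature.MathematicalPhysics.QuantumFieldTheory.Balaban1983to89.T3DescentFibreTower (descendTo_descendTo descendTo_self)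
open ExpMeanLog (deltaSU deltaSU_pos)
open Summit.QuantumFields.YangMills.Theorems.OrganTangentFibreMeanTools
open Summit.QuantumFields.YangMills.Theorems.OrganTangentFibreMeanToolsAnyCut
open Summit.QuantumFields.YangMills.Theorems.FluctuationComparisonRegPrIntLOrganTangentFibredChartDescendTo (descend_eq_descendTo')
open Summit.QuantumFields.YangMills.Theorems.FluctuationComparisonRegPrIntLOrganTangentModeLettersFromHeight (continuousOn_descend_of_small)

/-! ## §1 Generic factor families -/

section Generic

variable (F : T3Family) (t : (n : ℕ) → GaugeField (F.P n) 0 ↥(Matrix.specialUnitaryGroup (Fin 2) ℂ) → ℝ) (a : ℕ → ℝ) (j : ℕ)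

/-- The iterated weight is non-negative (factors `≥ 0`). [folklore] -/
theorem iterWeight_nonneg (ht0 : ∀ n U, 0 ≤ t n U) (K : ℕ) (U : GaugeField (F.P K) 0 ↥(Matrix.specialUnitaryGroup (Fin 2) ℂ)) :
    0 ≤ ∏ i ∈ Finset.range (K - j), (if h : j + 1 + i ≤ K then t (j + 1 + i) (descendTo F ℰp (j + 1 + i) K h U) else 1) :=
  Finset.prod_nonneg fun i _ => by
    by_cases h : j + 1 + i ≤ K
    · rw [dif_pos h]; exact ht0 _ _
    · rw [dif_neg h]; exact zero_le_one

/-- The iterated weight is `≤ 1` (factors in `[0, 1]`). [folklore] -/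
theorem iterWeight_le_one (ht0 : ∀ n U, 0 ≤ t n U) (ht1 : ∀ n U, t n U ≤ 1) (K : ℕ) (U : GaugeField (F.P K) 0 ↥(Matrix.specialUnitaryGroup (Fin 2) ℂ)) :
    (∏ i ∈ Finset.range (K - j), (if h : j + 1 + i ≤ K then t (j + 1 + i) (descendTo F ℰp (j + 1 + i) K h U) else 1)) ≤ 1 :=
  Finset.prod_le_one (fun i _ => by
    by_cases h : j + 1 + i ≤ K
    · rw [dif_pos h]; exact ht0 _ _
    · rw [dif_neg h]; exact zero_le_one) fun i _ => by
    by_cases h : j + 1 + i ≤ K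
    · rw [dif_pos h]; exact ht1 _ _
    · rw [dif_neg h]

/-- **SUPPORT**: where the iterated weight is non-zero, every intermediate average `descendTo n K U`, `n ∈ [j+1, K]`, is in its window `{PlaqSmall (a n)}`. [folklore] -/
theorem multiWindow_of_iterWeight_ne_zero (htsupp : ∀ n U, t n U ≠ 0 → PlaqSmall (a n) U) (K : ℕ) (U : GaugeField (F.P K) 0 ↥(Matrix.specialUnitaryGroup (Fin 2) ℂ))
    (hU : (∏ i ∈ Finset.range (K - j), (if h : j + 1 + i ≤ K then t (j + 1 + i) (descendTo F ℰp (j + 1 + i) K h U) else 1)) ≠ 0) :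
    ∀ (n : ℕ) (hjn : j + 1 ≤ n) (hnK : n ≤ K), PlaqSmall (a n) (descendTo F ℰp n K hnK U) := by
  intro n hjn hnK
  have hi : n - (j + 1) ∈ Finset.range (K - j) := Finset.mem_range.2 (by omega)
  have hfac := Finset.prod_ne_zero_iff.1 hU (n - (j + 1)) hi
  have hle : j + 1 + (n - (j + 1)) ≤ K := by omega
  rw [dif_pos hle] at hfac
  have key : ∀ (n' : ℕ) (hn' : n' = n) (h' : n' ≤ K), PlaqSmall (a n') (descendTo F ℰp n' K h' U) → PlaqSmall (a n) (descendTo F ℰp n K hnK U) := by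
    intro n' hn' h' hP
    subst hn'
    exact hP
  exact key (j + 1 + (n - (j + 1))) (by omega) hle (htsupp _ _ hfac)

/-- **POSITIVITY ON THE MULTI-LEVEL WINDOW**: if every factor is positive on its window, the iterated weight is positive on `MW`. [folklore] -/
theorem iterWeight_pos_of_multiWindow (htpos : ∀ n U, PlaqSmall (a n) U → 0 < t n U) (K : ℕ) (U : GaugeField (F.P K) 0 ↥(Matrix.specialUnitaryGroup (Fin 2) ℂ))
    (hU : ∀ (n : ℕ) (hjn : j + 1 ≤ n) (hnK : n ≤ K), PlaqSmall (a n) (descendTo F ℰp n K hnK U)) :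
    0 < ∏ i ∈ Finset.range (K - j), (if h : j + 1 + i ≤ K then t (j + 1 + i) (descendTo F ℰp (j + 1 + i) K h U) else 1) :=
  Finset.prod_pos fun i hi => by
    have hi' : i < K - j := Finset.mem_range.1 hi
    have hle : j + 1 + i ≤ K := by omega
    rw [dif_pos hle]
    exact htpos _ _ (hU (j + 1 + i) (by omega) hle)

/-- ★★ **CONTINUITY OF THE ITERATED WEIGHT.**  If every factor `t n` is continuous with `0 ≤ t n ≤ 1` and supported in the window `{PlaqSmall (a n)}`, and the block average
`descend F ℰp n` is continuous on `{PlaqSmall (a (n+1))}` for `j ≤ n < K`, then the iterated weight on `G_K` is continuous — at a point where the top factor vanishes it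
squeezes the bounded deeper factors, where it does not the field is in the top window and `descend_K` is continuous there. [cite: Balaban1987RG1, (0.18) p.255] -/
theorem continuous_iterWeight (ht : ∀ n, Continuous (t n)) (ht0 : ∀ n U, 0 ≤ t n U) (ht1 : ∀ n U, t n U ≤ 1)
    (htsupp : ∀ n U, t n U ≠ 0 → PlaqSmall (a n) U) :
    ∀ (K : ℕ) (hjK : j ≤ K),
      (∀ n, j ≤ n → n < K → ContinuousOn (descend F ℰp n : GaugeField (F.P (n + 1)) 0 ↥(Matrix.specialUnitaryGroup (Fin 2) ℂ) →
        GaugeField (F.P n) 0 ↥(Matrix.specialUnitaryGroup (Fin 2) ℂ)) {U | PlaqSmall (a (n + 1)) U}) →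
      Continuous fun U : GaugeField (F.P K) 0 ↥(Matrix.specialUnitaryGroup (Fin 2) ℂ) =>
        ∏ i ∈ Finset.range (K - j), (if h : j + 1 + i ≤ K then t (j + 1 + i) (descendTo F ℰp (j + 1 + i) K h U) else 1) := by
  intro K hjK
  induction K, hjK using Nat.le_induction with
  | base =>
    intro _
    simp only [Nat.sub_self, Finset.range_zero, Finset.prod_empty]
    exact continuous_const
  | succ K hjK IH =>
    intro hdesc
    have hIH := IH fun n hjn hnK => hdesc n hjn (by omega)
    have hdK := hdesc K hjK (Nat.lt_succ_self K)
    -- the weight at `K + 1` = (weight at `K`) ∘ descend_K × top factor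
    set WK : GaugeField (F.P K) 0 ↥(Matrix.specialUnitaryGroup (Fin 2) ℂ) → ℝ := fun V =>
      ∏ i ∈ Finset.range (K - j), (if h : j + 1 + i ≤ K then t (j + 1 + i) (descendTo F ℰp (j + 1 + i) K h V) else 1) with hWK
    have hsplit : (fun U : GaugeField (F.P (K + 1)) 0 ↥(Matrix.specialUnitaryGroup (Fin 2) ℂ) =>
        ∏ i ∈ Finset.range (K + 1 - j), (if h : j + 1 + i ≤ K + 1 then t (j + 1 + i) (descendTo F ℰp (j + 1 + i) (K + 1) h U) else 1)) =
        fun U => WK (descend F ℰp K U) * t (K + 1) U := by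
      funext U
      rw [show K + 1 - j = K - j + 1 by omega, Finset.prod_range_succ]
      congr 1
      · refine Finset.prod_congr rfl fun i hi => ?_
        have hi' : i < K - j := Finset.mem_range.1 hi
        have hle : j + 1 + i ≤ K := by omega
        have hle' : j + 1 + i ≤ K + 1 := by omega
        rw [dif_pos hle', dif_pos hle, descend_eq_descendTo' F K (Nat.le_succ K) U, descendTo_descendTo]
      · have hle : j + 1 + (K - j) ≤ K + 1 := by omega
        rw [dif_pos hle]
        have key : ∀ (n : ℕ) (hn : n = K + 1) (h : n ≤ K + 1), t n (descendTo F ℰp n (K + 1) h U) = t (K + 1) U := by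
          intro n hn h; subst hn; rw [descendTo_self]
        exact key _ (by omega) hle
    rw [hsplit]
    -- pointwise continuity
    refine continuous_iff_continuousAt.2 fun U₀ => ?_
    by_cases htop : t (K + 1) U₀ = 0
    · -- the top factor vanishes at `U₀`: squeeze (`|WK ∘ descend| ≤ 1`)
      have hbd : ∀ U, |WK (descend F ℰp K U)| ≤ 1 := fun U => by
        rw [abs_of_nonneg (iterWeight_nonneg F t j ht0 K _)]
        exact iterWeight_le_one F t j ht0 ht1 K _
      have h0 : Tendsto (fun U => t (K + 1) U) (nhds U₀) (nhds 0) := by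
        have := (ht (K + 1)).continuousAt (x := U₀)
        rw [ContinuousAt, htop] at this
        exact this
      have h0' : Tendsto (fun U => ‖t (K + 1) U‖) (nhds U₀) (nhds 0) := by simpa using h0.norm
      have hlim : Tendsto (fun U => WK (descend F ℰp K U) * t (K + 1) U) (nhds U₀) (nhds 0) :=
        squeeze_zero_norm (fun U => by
          rw [norm_mul]
          exact mul_le_of_le_one_left (norm_nonneg _) (by rw [Real.norm_eq_abs]; exact hbd U)) h0'
      rw [ContinuousAt, htop, mul_zero]
      exact hlim
    · -- the top factor is non-zero: `U₀` is in the open top window, where `descend_K` is continuous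
      have hU₀ : PlaqSmall (a (K + 1)) U₀ := htsupp _ _ htop
      haveI : BorelSpace (GaugeField (F.P (K + 1)) 0 ↥(Matrix.specialUnitaryGroup (Fin 2) ℂ)) := T3OrbitAverage.instBorelSpaceGaugeField
      have hopen : IsOpen {U : GaugeField (F.P (K + 1)) 0 ↥(Matrix.specialUnitaryGroup (Fin 2) ℂ) | PlaqSmall (a (K + 1)) U} := by
        have e : {U : GaugeField (F.P (K + 1)) 0 ↥(Matrix.specialUnitaryGroup (Fin 2) ℂ) | PlaqSmall (a (K + 1)) U} =
            ⋂ p : Plaq (F.P (K + 1)) 0, {U | dist1 (GaugeField.plaqHol U p) < a (K + 1)} := by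
          ext U; simp only [PlaqSmall, Set.mem_setOf_eq, Set.mem_iInter]
        rw [e]
        exact isOpen_iInter_of_finite fun p => isOpen_lt (continuous_dist1_plaqHol p) continuous_const
      have hdc : ContinuousAt (descend F ℰp K : GaugeField (F.P (K + 1)) 0 ↥(Matrix.specialUnitaryGroup (Fin 2) ℂ) →
          GaugeField (F.P K) 0 ↥(Matrix.specialUnitaryGroup (Fin 2) ℂ)) U₀ := (hdK U₀ hU₀).continuousAt (hopen.mem_nhds hU₀)
      exact ((hIH.continuousAt).comp hdc).mul (ht (K + 1)).continuousAt

end Generic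

/-! ## §2 The frame's multi-level-window weight from a height -/

/-- ★★★ **THE FRAME'S WEIGHT `χ_{j,K} = ∏ sfCut θ_n ∘ descendTo n K` IS A KNIT-MW WEIGHT FROM A HEIGHT**: for every family `F`, `0 < γ ≤ 1`, `0 < b₀` there is `jA` such that for all
`j ≥ jA`, `K ≥ j+1`: `χ_{j,K}` is continuous, takes values in `[0, 1]`, is supported in `MW_{j,K}` and positive on it — the four `χ`-binders of
✓`…FibreMeanVersionKnitDescendTo.fibreMeanVersion_descendTo_of_regularSmallFieldDisintegration_ac` for the R-CUT-χ token at every level.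
[cite: Balaban1987RG1, (0.11) p.253 and (0.18) p.255; Balaban1985Averaging, (10)-(13) p.19; Balaban1985UV3, (7) p.257] -/
theorem exists_height_multiWindowWeight (F : T3Family) (γ b₀ p₀ : ℝ) (hγ : 0 < γ) (hγ1 : γ ≤ 1) (hb₀ : 0 < b₀) :
    ∃ jA : ℕ, ∀ (j : ℕ), jA ≤ j → ∀ (K : ℕ) (hjK : j + 1 ≤ K),
      Continuous (fun U : GaugeField (F.P K) 0 ↥(Matrix.specialUnitaryGroup (Fin 2) ℂ) =>
        ∏ i ∈ Finset.range (K - j), (if h : j + 1 + i ≤ K then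
          (∏ p : Plaq (F.P (j + 1 + i)) 0, max 0 (min 1 ((24 / 25 * θBal F.L γ b₀ p₀ (j + 1 + i) - dist1 (GaugeField.plaqHol (descendTo F ℰp (j + 1 + i) K h U) p)) /
            ((24 / 25 - 1 / 2) * θBal F.L γ b₀ p₀ (j + 1 + i))))) else 1)) ∧
      (∀ U : GaugeField (F.P K) 0 ↥(Matrix.specialUnitaryGroup (Fin 2) ℂ),
        0 ≤ ∏ i ∈ Finset.range (K - j), (if h : j + 1 + i ≤ K then
          (∏ p : Plaq (F.P (j + 1 + i)) 0, max 0 (min 1 ((24 / 25 * θBal F.L γ b₀ p₀ (j + 1 + i) - dist1 (GaugeField.plaqHol (descendTo F ℰp (j + 1 + i) K h U) p)) /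
            ((24 / 25 - 1 / 2) * θBal F.L γ b₀ p₀ (j + 1 + i))))) else 1)) ∧
      (∀ U : GaugeField (F.P K) 0 ↥(Matrix.specialUnitaryGroup (Fin 2) ℂ),
        (∏ i ∈ Finset.range (K - j), (if h : j + 1 + i ≤ K then
          (∏ p : Plaq (F.P (j + 1 + i)) 0, max 0 (min 1 ((24 / 25 * θBal F.L γ b₀ p₀ (j + 1 + i) - dist1 (GaugeField.plaqHol (descendTo F ℰp (j + 1 + i) K h U) p)) /
            ((24 / 25 - 1 / 2) * θBal F.L γ b₀ p₀ (j + 1 + i))))) else 1)) ≠ 0 →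
        ∀ (n : ℕ) (hjn : j + 1 ≤ n) (hnK : n ≤ K), PlaqSmall (24 / 25 * θBal F.L γ b₀ p₀ n) (descendTo F ℰp n K hnK U)) ∧
      (∀ U : GaugeField (F.P K) 0 ↥(Matrix.specialUnitaryGroup (Fin 2) ℂ),
        (∀ (n : ℕ) (hjn : j + 1 ≤ n) (hnK : n ≤ K), PlaqSmall (24 / 25 * θBal F.L γ b₀ p₀ n) (descendTo F ℰp n K hnK U)) →
        0 < ∏ i ∈ Finset.range (K - j), (if h : j + 1 + i ≤ K then
          (∏ p : Plaq (F.P (j + 1 + i)) 0, max 0 (min 1 ((24 / 25 * θBal F.L γ b₀ p₀ (j + 1 + i) - dist1 (GaugeField.plaqHol (descendTo F ℰp (j + 1 + i) K h U) p)) /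
            ((24 / 25 - 1 / 2) * θBal F.L γ b₀ p₀ (j + 1 + i))))) else 1)) := by
  -- the factor family and its radii
  set t : (n : ℕ) → GaugeField (F.P n) 0 ↥(Matrix.specialUnitaryGroup (Fin 2) ℂ) → ℝ := fun n V =>
    ∏ p : Plaq (F.P n) 0, max 0 (min 1 ((24 / 25 * θBal F.L γ b₀ p₀ n - dist1 (GaugeField.plaqHol V p)) / ((24 / 25 - 1 / 2) * θBal F.L γ b₀ p₀ n))) with ht_def
  set a : ℕ → ℝ := fun n => 24 / 25 * θBal F.L γ b₀ p₀ n with ha_def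
  have hc : (1 / 2 : ℝ) < 24 / 25 := half_lt_twentyFour_div_twentyFive_and_lt_one.1
  have hθpos : ∀ n, 0 < θBal F.L γ b₀ p₀ n := fun n => T3MinimiserStabilityReduction.θBal_pos F.hL.2.le hγ hγ1 hb₀ p₀ n
  have ht : ∀ n, Continuous (t n) := fun n => continuous_sfCutRamp (1 / 2) (24 / 25) _
  have ht0 : ∀ n U, 0 ≤ t n U := fun n U => sfCutRamp_nonneg (1 / 2) (24 / 25) _ U
  have ht1 : ∀ n U, t n U ≤ 1 := fun n U => sfCutRamp_le_one (1 / 2) (24 / 25) _ U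
  have htsupp : ∀ n U, t n U ≠ 0 → PlaqSmall (a n) U := fun n U hU => plaqSmall_of_sfCutRamp_ne_zero hc (hθpos n) U hU
  have htpos : ∀ n U, PlaqSmall (a n) U → 0 < t n U := fun n U hU => sfCutRamp_pos_of_plaqSmall hc (hθpos n) U hU
  -- the height: `((5L)²∕4)·(24∕25)θ_n < δ₂` for all `n > jA`
  have hL3 : (3 : ℝ) ≤ F.L := by exact_mod_cast (FluctuationComparisonRegPrIntLOrganTangentAPackageFromHeight.torus_d_L F 0).2.2
  set τ : ℝ := deltaSU (Fin 2) / (7 * (F.L : ℝ) ^ 2) with hτ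
  have hτpos : 0 < τ := by rw [hτ]; exact div_pos deltaSU_pos (by positivity)
  obtain ⟨j₁, hj₁⟩ := eventually_atTop.1 ((T3ThresholdSmallness.tendsto_θBal_atTop F.hL.2 hγ b₀ p₀).eventually (gt_mem_nhds hτpos))
  have hsmall : ∀ n, j₁ ≤ n → (((((F.P (n + 1)).d + 2) * (F.P (n + 1)).L : ℕ) : ℝ) ^ 2 / 4) * a (n + 1) < deltaSU (Fin 2) := by
    intro n hn
    have h1 : θBal F.L γ b₀ p₀ (n + 1) < τ := hj₁ (n + 1) (by omega)
    have e : (((((F.P (n + 1)).d + 2) * (F.P (n + 1)).L : ℕ) : ℝ) ^ 2 / 4) * a (n + 1) = 6 * (F.L : ℝ) ^ 2 * θBal F.L γ b₀ p₀ (n + 1) := by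
      have : ((F.P (n + 1)).d + 2) * (F.P (n + 1)).L = 5 * F.L := rfl
      rw [this, ha_def]; push_cast; ring
    rw [e]
    have h2 : 6 * (F.L : ℝ) ^ 2 * τ ≤ deltaSU (Fin 2) := by
      rw [hτ, show 6 * (F.L : ℝ) ^ 2 * (deltaSU (Fin 2) / (7 * (F.L : ℝ) ^ 2)) = deltaSU (Fin 2) * (6 / 7) by field_simp]
      linarith [deltaSU_pos (n := Fin 2)]
    calc 6 * (F.L : ℝ) ^ 2 * θBal F.L γ b₀ p₀ (n + 1) < 6 * (F.L : ℝ) ^ 2 * τ := by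
          exact mul_lt_mul_of_pos_left h1 (by positivity)
      _ ≤ deltaSU (Fin 2) := h2
  refine ⟨j₁, fun j hj K hjK => ⟨?_, fun U => iterWeight_nonneg F t j ht0 K U, fun U hU => multiWindow_of_iterWeight_ne_zero F t a j htsupp K U hU,
    fun U hU => iterWeight_pos_of_multiWindow F t a j htpos K U hU⟩⟩
  refine continuous_iterWeight F t a j ht ht0 ht1 htsupp K (Nat.le_of_succ_le hjK) fun n hjn _ => ?_
  exact continuousOn_descend_of_small F n (mul_pos (by norm_num) (hθpos (n + 1))).le (hsmall n (by omega))

end Summit.QuantumFields.YangMills.Theorems.FluctuationComparisonRegPrIntLOrganTangentMultiWindowWeight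

end
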